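import Summits.CriticalPhenomena.PercolationContinuityZ3.Theorems.PercNearOneGluingNoHeavyPcintKernNFZ5B7Check1
import Summits.CriticalPhenomena.PercolationContinuityZ3.Theorems.PercNearOneGluingNoHeavyPcintKernNFZ5B7Check2
import Summits.CriticalPhenomena.PercolationContinuityZ3.Theorems.PercNearOneGluingNoHeavyPcintKernNFZ5B7Check3
import Summits.CriticalPhenomena.PercolationContinuityZ3.Theorems.PercNearOneGluingNoHeavyPcintKernNFZ5B7Check4
import HarnessLib

/-!
# PCINT lane: `p_c^bond(ℤ⁵) ≥ 0.1145` (kernel-checked B3r window certificate on normal forms, memory 7 (6-step windows; 1538 first-use normal forms of 1000000 codes); printed best lower bound 0.11286 (Noonan 1998 / Pönitz–Tittmann 2000)).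

Cell `prim-pcint`, seat `prim-pcint-2` (gen 2); memo `run/shared/lean/prim/pcint/INTERVAL-PLAN.md` §15.  Does NOT build on p205010.
Assembles the kernel-checked row blocks (`…KernNFZ5B7Check1` with the linear table; `…Check2..4` on the search tree, converted once by
`WinK.all_rowOKBK_of_tree` after checking `ordered` and `toList = tbl` by `decide`), closes the enumeration (`WinK.all_nfCodes_of_nfCodesIn`,
`WinK.allRange_nfOKB_of_nfCodes`) and applies `WinK.le_criticalProb_of_checkBK` (`…PcintWinKernelSymCert`).
No external certificate, no `native_decide`; axioms standard.
-/

namespace Summit.CriticalPhenomena.PercolationContinuityZ3.Theorems.Pcint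

open Literature.Probability.Percolation Literature.Probability.LatticeModels NFZ5B7

set_option maxHeartbeats 0 in
/-- All Collatz–Wielandt rows on the normal forms of the `1000000` window codes check. [folklore] -/
theorem NFZ5B7.chkAll : (WinK.nfCodes 5 6).all (WinK.rowOKBK 5 5 1145 10066 9935 99999 tbl 72351) = true :=
  WinK.all_nfCodes_of_nfCodesIn (hi := 1000000) (WinK.all_of_allB (fuel := 20) (by decide +kernel))
    (WinK.all_nfCodesIn_append chkFile_1
      (WinK.all_rowOKBK_of_tree (t := WinK.KT.ofListF 11 tbl) (by decide +kernel) (by decide +kernel)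
        (WinK.all_nfCodesIn_append (WinK.all_nfCodesIn_append chkFile_2 chkFile_3) chkFile_4)))

/-- **`p_c^bond(ℤ⁵) ≥ 0.1145`** (kernel-checked B3r window certificate on normal forms, memory 7 (6-step windows; 1538 first-use normal forms of 1000000 codes); printed best lower bound 0.11286 (Noonan 1998 / Pönitz–Tittmann 2000)). [folklore] -/
theorem criticalProb_Z5_ge_01145 : (0.1145 : ℝ) ≤ criticalProb (zdGraph 5) 0 := by
  have h := WinK.le_criticalProb_of_checkBK (d := 5) (m := 5) (pn := 1145) (R := 10066) (S := 9935) (lamN := 99999)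
      (tbl := tbl) (dflt := 72351) (vlo := 72351) (vhi := 100000) (by norm_num) (by norm_num) (by norm_num) (by norm_num)
      (by norm_num) (by norm_num) (by norm_num) (by norm_num) tbl_bounds (by norm_num) (by norm_num)
      (WinK.allRange_nfOKB_of_nfCodes chkAll)
  have e : ((1145 : ℕ) : ℝ) / 10 ^ 4 = 0.1145 := by norm_num
  rw [e] at h
  exact h

end Summit.CriticalPhenomena.PercolationContinuityZ3.Theorems.Pcint
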